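import Summits.BirchSwinnertonDyer.Rank1Residual.X11b.KummerLocalTorsionSaturation
import Summits.BirchSwinnertonDyer.Rank1Residual.Additive.AdicIntegersQuotientPrimePowCard
import Literature.NumberTheory.EllipticCurves.Kato2004.LocPKummerLog
import HarnessLib

/-!
# The kernel of `ι_k : H¹(K_v, E[p^k]) → H¹(K_v, E[p^∞])` has order `#E(K_v)[p^k]`, and the image of the local Kummer
# condition in `H¹(K_v, E[p^∞])` has order `#(𝓞_v / p^k)` (over `ℚ` at `v_p`: exactly `p^k`)
# (route `KatoDescentPotSupersingular` / `…Tame…`, crux M = stmt-BirchSwinnertonDyer-19196; route-free helper)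

Seat `bsd-potss-rkm` g19 (prover; cell `bsd-potss`), item stmt-BirchSwinnertonDyer-19196 (`--supports … --as helper`; closes
nothing).  HONEST FRAMING: BSD is not proved by any of this; nothing is booked; theorems only (no definition, no named fact):
TOOL theorems of local Galois cohomology of elliptic curves.

## Why (brick (a) of crux M's level-0 ledger, step "L1 / `#Z_K`" of memo `HOME/rkm/FINDING-19196-rkm-g18.md` §ARCHITECTURE)

The sharp S-side inequality `#S(E[p^∞]) ≤ #Sel_str^{ur} · p^k/#im_k(A)` bounds `loc_p` of Kato's group `S` inside the image,
in `H¹(ℚ_p, E[p^∞])`, of a subgroup `X ≤ 𝓚_k` of the level-`p^k` Kummer condition; the passage from `#X` to `#ι_k(X)` divides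
by the order of `Z_k = ker ι_k ∩ X = ker ι_k` (when `Z_k ≤ X`).  The tree knows `Z_k` EXACTLY:
`ker ι_k = κ_{p^k}(E(K_v)_tors)` (X11b `LevelKummer.map_torsion_localKummerMap_eq_ker_map_primaryInclusion`) and
`ker ι_k ≤ 𝓚_k` (`LevelKummer.ker_map_primaryInclusion_le_kummerLocalConditionAt`).  This file COUNTS it:

* §1 (group theory) `natCard_map_mul_natCard_ker_of_le`: `#f(X) · #ker f = #X` for `ker f ≤ X`;
  `natCard_quotient_range_nsmul_eq_natCard_ker`: `#(T / nT) = #T[n]` for a finite abelian group `T`.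
* §2 `finite_torsion_baseChange_adicCompletion`: the torsion subgroup of `E(K_v)` is finite (it meets the torsion-free
  finite-index subgroup `U` of Silverman VII.6.3 / the tree's `exists_finiteIndex_torsionFree_adicCompletion` trivially);
  **`natCard_map_torsion_localKummerMap`: `#κ_n(E(K_v)_tors) = #E(K_v)[n]`** (`κ_n` restricted to the torsion `T` has kernel
  `T ∩ nE(K_v) = nT`, and `#(T/nT) = #T[n] = #E(K_v)[n]`).
* §3 **`natCard_ker_map_primaryInclusion_restrictField`: `#ker(H¹(K_v,E[p^k]) → H¹(K_v,E[p^∞])) = #E(K_v)[p^k]`** at every finite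
  place `v` of a number field (any `p`, `k`); **`natCard_map_primaryInclusion_mul_of_ker_le`: `#ι_k(X) · #E(K_v)[p^k] = #X`** for
  every `X ≥ ker ι_k`; **`natCard_map_primaryInclusion_kummerLocalConditionAt`: `#ι_k(𝓚_v) = #(𝓞_v/p^k 𝓞_v)`** (so `= 1` at `v ∤ p`,
  recovering X11b's `𝓚_v = ker ι_k` there, and over `ℚ` at `v_p`: **`#ι_k(𝓚_{v_p}) = p^k`**, `…_primePlace`) — the image of
  `E(ℚ_p)/p^k` in `H¹(ℚ_p, E[p^∞])` has exactly `p^k` elements: the `T`-adic count `E(ℚ_p) ⊗ ℤ/p^k → H¹(ℚ_p,E[p^∞])[p^k]`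
  has image `(E(ℚ_p)/tors)/p^k ≅ ℤ/p^k` — no loss `p^{t_p}`.

References: J. S. Milne, *ADT* I Lemma 3.3, §6 [MilneADT2006]; J. H. Silverman, *AEC* VII.6.3, VIII §2, X §4 [SilvermanAEC2009];
R. Greenberg, LNM 1716 §5, proof of Prop. 5.8 [GreenbergLNM1716]; K. Kato, Astérisque 295, proof of Prop. 14.16 (pp. 244–245)
[Kato2004Asterisque].
-/

-- the summit and its single problem are both named `BirchSwinnertonDyer` (registry layout D-0017)
set_option linter.dupNamespace false
set_option autoImplicit false

noncomputable section

open scoped Classical ContRepresentation NumberField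
open Function Field NumberField IsDedekindDomain
open Literature.NumberTheory.EllipticCurves Literature.NumberTheory.GaloisRepresentations
open Literature.NumberTheory.EllipticCurves.Kato2004
open Summit.BirchSwinnertonDyer.Rank1Residual.X11b.Levels Summit.BirchSwinnertonDyer.Rank1Residual.X11b.LocBridge
  Summit.BirchSwinnertonDyer.Rank1Residual.X11b.LevelKummer

universe u

namespace Summit.BirchSwinnertonDyer.BirchSwinnertonDyer.Theorems.KatoFiniteLevelCount

/-! ## §1 Group theory: `#f(X) · #ker f = #X` for `ker f ≤ X`; `#(T/nT) = #T[n]` for finite `T` -/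

section GroupTheory

variable {A B : Type*} [AddCommGroup A] [AddCommGroup B]

/-- `[X : ker f ∩ X] = #f(X)`: the relative index of the kernel in `X` is the order of the image of `X` (first isomorphism
theorem for `f|_X`). [folklore] -/
theorem relIndex_ker_eq_natCard_map (f : A →+ B) (X : AddSubgroup A) : f.ker.relIndex X = Nat.card (X.map f) := by
  rw [AddSubgroup.relIndex, ← AddMonoidHom.ker_restrict, AddSubgroup.index_ker, AddMonoidHom.restrict_range]

/-- **`#f(X) · #ker f = #X` whenever `ker f ≤ X`** (orders as `Nat.card`, `0` for infinite groups). [folklore] -/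
theorem natCard_map_mul_natCard_ker_of_le (f : A →+ B) {X : AddSubgroup A} (hX : f.ker ≤ X) :
    Nat.card (X.map f) * Nat.card f.ker = Nat.card X := by
  rw [← relIndex_ker_eq_natCard_map, mul_comm, AddSubgroup.relIndex,
    ← Nat.card_congr (AddSubgroup.addSubgroupOfEquivOfLe hX).toEquiv]
  exact AddSubgroup.card_mul_index _

/-- **`#(T / nT) = #T[n]`** for a finite abelian group `T` (both equal `#T / #nT`). [folklore] -/
theorem natCard_quotient_range_nsmul_eq_natCard_ker [Finite A] (n : ℕ) :
    Nat.card (A ⧸ (nsmulAddMonoidHom n : A →+ A).range) = Nat.card (nsmulAddMonoidHom n : A →+ A).ker := by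
  have h1 : Nat.card (nsmulAddMonoidHom n : A →+ A).ker * (nsmulAddMonoidHom n : A →+ A).ker.index = Nat.card A :=
    AddSubgroup.card_mul_index _
  have h2 : Nat.card (nsmulAddMonoidHom n : A →+ A).range * (nsmulAddMonoidHom n : A →+ A).range.index = Nat.card A :=
    AddSubgroup.card_mul_index _
  rw [AddSubgroup.index_ker] at h1
  rw [AddSubgroup.index, mul_comm] at h2
  have hpos : 0 < Nat.card (nsmulAddMonoidHom n : A →+ A).range := Nat.card_pos
  exact Nat.eq_of_mul_eq_mul_right hpos (h2.trans h1.symm)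

end GroupTheory

/-! ## §2 The torsion of `E(K_v)` is finite and `#κ_n(E(K_v)_tors) = #E(K_v)[n]` -/

section LocalTorsion

variable {K : Type u} [Field K] [NumberField K] (W : WeierstrassCurve K) [W.IsElliptic] (v : HeightOneSpectrum (𝓞 K))

/-- **The torsion subgroup of `E(K_v)` is finite** at every finite place `v` of a number field: it meets the torsion-free
finite-index subgroup `U ≤ E(K_v)` of Silverman VII.6.3 (tree `exists_finiteIndex_torsionFree_adicCompletion`) trivially, so
it injects into the finite quotient `E(K_v)/U`. [cite: SilvermanAEC2009, Prop. VII.6.3] [cite: MilneADT2006, I Lemma 3.3] -/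
theorem finite_torsion_baseChange_adicCompletion :
    Finite (AddCommGroup.torsion (W.baseChange (v.adicCompletion K)).toAffine.Point) := by
  obtain ⟨U, hU, htf, -⟩ := W.exists_finiteIndex_torsionFree_adicCompletion v
  haveI := hU
  haveI : Finite ((W.baseChange (v.adicCompletion K)).toAffine.Point ⧸ U) := AddSubgroup.finite_quotient_of_finiteIndex
  refine Finite.of_injective (fun t : AddCommGroup.torsion (W.baseChange (v.adicCompletion K)).toAffine.Point =>
    (QuotientAddGroup.mk (t : (W.baseChange (v.adicCompletion K)).toAffine.Point) : _ ⧸ U)) fun t t' h => ?_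
  apply Subtype.ext
  have hmem : (t : (W.baseChange (v.adicCompletion K)).toAffine.Point) - t' ∈ U := by
    rw [← QuotientAddGroup.eq_iff_sub_mem]; exact h
  have htors : IsOfFinAddOrder ((t : (W.baseChange (v.adicCompletion K)).toAffine.Point) - t') :=
    (AddCommGroup.mem_torsion _).mp (sub_mem t.2 t'.2)
  obtain ⟨n, hn, hn0⟩ := htors.exists_nsmul_eq_zero
  exact sub_eq_zero.mp (htf n hn.ne' _ hmem hn0)

/-- `T ∩ nE = nT` for the torsion subgroup `T` of any abelian group `E`: an `n`-th root of a torsion point is torsion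
(`n ≠ 0`). [folklore] -/
theorem range_zsmul_addSubgroupOf_torsion {M : Type*} [AddCommGroup M] {n : ℕ} (hn : n ≠ 0) :
    (zsmulAddGroupHom (n : ℤ) : M →+ M).range.addSubgroupOf (AddCommGroup.torsion M) =
      (nsmulAddMonoidHom n : AddCommGroup.torsion M →+ AddCommGroup.torsion M).range := by
  ext ⟨t, ht⟩
  rw [AddSubgroup.mem_addSubgroupOf, AddMonoidHom.mem_range, AddMonoidHom.mem_range]
  constructor
  · rintro ⟨R, hR⟩
    rw [zsmulAddGroupHom_apply, natCast_zsmul] at hR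
    have hRt : IsOfFinAddOrder R := by
      have ht' : IsOfFinAddOrder t := (AddCommGroup.mem_torsion _).mp ht
      obtain ⟨m, hm, hm0⟩ := ht'.exists_nsmul_eq_zero
      refine isOfFinAddOrder_iff_nsmul_eq_zero.mpr ⟨m * n, Nat.mul_pos hm (Nat.pos_of_ne_zero hn), ?_⟩
      change (m * n) • R = 0
      rw [mul_smul, hR]
      exact hm0
    exact ⟨⟨R, (AddCommGroup.mem_torsion _).mpr hRt⟩, Subtype.ext (by rw [nsmulAddMonoidHom_apply]; exact hR)⟩
  · rintro ⟨R, hR⟩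
    refine ⟨(R : M), ?_⟩
    rw [zsmulAddGroupHom_apply, natCast_zsmul]
    exact congrArg Subtype.val hR

/-- **`#κ_n(E(K_v)_tors) = #E(K_v)[n]`** (`n ≠ 0`, `v` a finite place of a number field): the local Kummer map `κ_n` (tree
`WeierstrassCurve.localKummerMap`, kernel `nE(K_v)`) restricted to the finite torsion subgroup `T` has kernel `T ∩ nE(K_v) = nT`,
so `#κ_n(T) = #(T/nT) = #T[n] = #E(K_v)[n]`. [cite: SilvermanAEC2009, VIII §2 and X §4 (the Kummer sequence)] [cite: MilneADT2006, I Lemma 3.3] -/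
theorem natCard_map_torsion_localKummerMap {n : ℕ} (hn : n ≠ 0) :
    Nat.card ((AddCommGroup.torsion (W.baseChange (v.adicCompletion K)).toAffine.Point).map
        (W.localKummerMap (v.adicCompletion K) (Int.natCast_ne_zero.mpr hn : (n : ℤ) ≠ 0))) =
      Nat.card (nsmulAddMonoidHom n : (W.baseChange (v.adicCompletion K)).toAffine.Point →+ _).ker := by
  haveI : CharZero (v.adicCompletion K) := charZero_adicCompletion v
  haveI := finite_torsion_baseChange_adicCompletion W v
  set M := (W.baseChange (v.adicCompletion K)).toAffine.Point
  set T := AddCommGroup.torsion M with hT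
  set κ := W.localKummerMap (v.adicCompletion K) (Int.natCast_ne_zero.mpr hn : (n : ℤ) ≠ 0) with hκ
  -- `#κ(T) = [T : ker κ ∩ T]` and `ker κ ∩ T = nT`
  have h1 : Nat.card (T.map κ) = κ.ker.relIndex T := (relIndex_ker_eq_natCard_map κ T).symm
  have hker : κ.ker.addSubgroupOf T = (nsmulAddMonoidHom n : T →+ T).range := by
    rw [hκ, W.ker_localKummerMap (v.adicCompletion K)]
    exact range_zsmul_addSubgroupOf_torsion (M := M) hn
  rw [h1, AddSubgroup.relIndex, hker, AddSubgroup.index, natCard_quotient_range_nsmul_eq_natCard_ker]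
  -- `#T[n] = #E(K_v)[n]`: every `n`-torsion point is torsion
  refine Nat.card_congr (Equiv.ofBijective (fun x => ⟨(x.1 : M), by
      have hx := x.2
      rw [AddMonoidHom.mem_ker, nsmulAddMonoidHom_apply] at hx ⊢
      exact congrArg Subtype.val hx⟩) ⟨fun x y h => ?_, fun ⟨P, hP⟩ => ?_⟩)
  · have h' := congrArg (fun z : (nsmulAddMonoidHom n : M →+ M).ker => (z : M)) h
    dsimp only at h'
    exact Subtype.ext (Subtype.ext h')
  · rw [AddMonoidHom.mem_ker, nsmulAddMonoidHom_apply] at hP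
    have hPt : P ∈ T := (AddCommGroup.mem_torsion _).mpr
      (isOfFinAddOrder_iff_nsmul_eq_zero.mpr ⟨n, Nat.pos_of_ne_zero hn, hP⟩)
    exact ⟨⟨⟨P, hPt⟩, by rw [AddMonoidHom.mem_ker, nsmulAddMonoidHom_apply]; exact Subtype.ext hP⟩, rfl⟩

end LocalTorsion

/-! ## §3 `#ker ι_k = #E(K_v)[p^k]`, `#ι_k(X)·#E(K_v)[p^k] = #X` for `X ≥ ker ι_k`, `#ι_k(𝓚_v) = #(𝓞_v/p^k)` -/

section KummerImage

variable {K : Type u} [Field K] [NumberField K] (W : WeierstrassCurve K) [W.IsElliptic] (p k : ℕ) [Fact p.Prime]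
  (v : HeightOneSpectrum (𝓞 K))

/-- **`#ker(H¹(K_v, E[p^k]) → H¹(K_v, E[p^∞])) = #E(K_v)[p^k]`** at every finite place `v` of a number field: the kernel is
`κ_{p^k}(E(K_v)_tors)` (X11b `map_torsion_localKummerMap_eq_ker_map_primaryInclusion`), of order `#E(K_v)[p^k]` (§2).
[cite: GreenbergLNM1716, §5 proof of Prop. 5.8] [cite: MilneADT2006, I Lemma 3.3] -/
theorem natCard_ker_map_primaryInclusion_restrictField :
    Nat.card (galoisCohomology.map ((primaryInclusion W p k).restrictField (v.adicCompletion K)) 1).ker =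
      Nat.card (nsmulAddMonoidHom (p ^ k) : (W.baseChange (v.adicCompletion K)).toAffine.Point →+ _).ker := by
  haveI : CharZero (v.adicCompletion K) := charZero_adicCompletion v
  have hn : p ^ k ≠ 0 := pow_ne_zero k (Fact.out : p.Prime).ne_zero
  rw [← map_torsion_localKummerMap_eq_ker_map_primaryInclusion W p k (v.adicCompletion K) (Int.natCast_ne_zero.mpr hn)]
  exact natCard_map_torsion_localKummerMap W v hn

/-- **`#ι_k(X) · #E(K_v)[p^k] = #X`** for every subgroup `X ≤ H¹(K_v, E[p^k])` containing `ker ι_k` (e.g. any `X` between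
`ker ι_k` and the local Kummer condition, X11b `ker_map_primaryInclusion_le_kummerLocalConditionAt`).
[cite: GreenbergLNM1716, §5 proof of Prop. 5.8] [cite: MilneADT2006, I Lemma 3.3] -/
theorem natCard_map_primaryInclusion_mul_of_ker_le
    {X : AddSubgroup (galoisCohomology (GaloisRep.restrictField (v.adicCompletion K)
      (W.torsionGaloisModule ((p ^ k : ℕ) : ℤ))) 1)}
    (hX : (galoisCohomology.map ((primaryInclusion W p k).restrictField (v.adicCompletion K)) 1).ker ≤ X) :
    Nat.card (X.map (galoisCohomology.map ((primaryInclusion W p k).restrictField (v.adicCompletion K)) 1)) *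
        Nat.card (nsmulAddMonoidHom (p ^ k) : (W.baseChange (v.adicCompletion K)).toAffine.Point →+ _).ker =
      Nat.card X := by
  rw [← natCard_ker_map_primaryInclusion_restrictField W p k v]
  exact natCard_map_mul_natCard_ker_of_le _ hX

/-- **`#ι_k(𝓚_v) = #(𝓞_v / p^k 𝓞_v)`**: the image in `H¹(K_v, E[p^∞])` of the level-`p^k` local Kummer condition
`𝓚_v = im(E(K_v)/p^k → H¹(K_v, E[p^k]))` (order `#E(K_v)[p^k]·#(𝓞_v/p^k)`, Milne I Lemma 3.3) has order `#(𝓞_v/p^k)` — `1` at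
`v ∤ p` (where indeed `𝓚_v = ker ι_k`, X11b `kummerLocalConditionAt_eq_ker_map_primaryInclusion`), `p^{k[K_v:ℚ_p]}` at `v ∣ p`.
[cite: MilneADT2006, I Lemma 3.3 and §6 (6.14)] [cite: GreenbergLNM1716, §5 proof of Prop. 5.8] -/
theorem natCard_map_primaryInclusion_kummerLocalConditionAt :
    Nat.card ((W.kummerLocalConditionAt ((p ^ k : ℕ) : ℤ) (v.adicCompletion K)).map
        (galoisCohomology.map ((primaryInclusion W p k).restrictField (v.adicCompletion K)) 1)) =
      Nat.card (v.adicCompletionIntegers K ⧸ Ideal.span {((p ^ k : ℕ) : v.adicCompletionIntegers K)}) := by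
  have hn : p ^ k ≠ 0 := pow_ne_zero k (Fact.out : p.Prime).ne_zero
  haveI := W.finite_ker_nsmul_adicCompletion v hn
  have hpos : 0 < Nat.card (nsmulAddMonoidHom (p ^ k) : (W.baseChange (v.adicCompletion K)).toAffine.Point →+ _).ker :=
    Nat.card_pos
  refine Nat.eq_of_mul_eq_mul_right hpos ?_
  rw [natCard_map_primaryInclusion_mul_of_ker_le W p k v (ker_map_primaryInclusion_le_kummerLocalConditionAt W p k _),
    W.natCard_kummerLocalConditionAt_adicCompletion v hn, mul_comm]

/-- **Over `ℚ` at `v_p`: `#ι_k(𝓚_{v_p}) = p^k`** — the image of `E(ℚ_p)/p^k` in `H¹(ℚ_p, E[p^∞])` has exactly `p^k` elements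
(`#(ℤ_p/p^k) = p^k`, tree `natCard_quot_adicCompletionIntegers_prime_pow_rat`). This is the local factor `p^K` of brick (a)
`#S(E[p^∞]) ≤ #Sel_str^{ur} · p^K/#im_K(A)` — the torsion `p^{t_p}` has cancelled EXACTLY.
[cite: MilneADT2006, I Lemma 3.3] [cite: Kato2004Asterisque, proof of Prop. 14.16 (pp. 244–245)] -/
theorem natCard_map_primaryInclusion_kummerLocalConditionAt_primePlace (W : WeierstrassCurve ℚ) [W.IsElliptic] :
    Nat.card ((W.kummerLocalConditionAt ((p ^ k : ℕ) : ℤ) ((primePlace p).adicCompletion ℚ)).map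
        (galoisCohomology.map ((primaryInclusion W p k).restrictField ((primePlace p).adicCompletion ℚ)) 1)) = p ^ k := by
  rw [natCard_map_primaryInclusion_kummerLocalConditionAt,
    Rank1Residual.Additive.DefectCountFiniteLevel.natCard_quot_adicCompletionIntegers_prime_pow_rat (coe_primesEquiv_primePlace p) k]

/-- The same two counts for the local condition `𝓚_{v}` of the Kummer SELMER STRUCTURE at `Sum.inr v` (definitionally the local
Kummer condition at `K_v`): `#ι_k(𝓚_v)·#E(K_v)[p^k] = #𝓚_v`. [cite: MilneADT2006, I Lemma 3.3 and §6 (6.14)] -/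
theorem natCard_map_primaryInclusion_kummerSelmerStructure_inr_mul :
    Nat.card ((W.kummerSelmerStructure ((p ^ k : ℕ) : ℤ) (Sum.inr v)).map
        (galoisCohomology.map ((primaryInclusion W p k).restrictField (v.adicCompletion K)) 1)) *
        Nat.card (nsmulAddMonoidHom (p ^ k) : (W.baseChange (v.adicCompletion K)).toAffine.Point →+ _).ker =
      Nat.card (W.kummerSelmerStructure ((p ^ k : ℕ) : ℤ) (Sum.inr v)) :=
  natCard_map_primaryInclusion_mul_of_ker_le W p k v (ker_map_primaryInclusion_le_kummerLocalConditionAt W p k _)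

end KummerImage

end Summit.BirchSwinnertonDyer.BirchSwinnertonDyer.Theorems.KatoFiniteLevelCount

end
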